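import Summits.BirchSwinnertonDyer.Rank1Residual.Additive.SubSelmerControlZeroExact
import Summits.BirchSwinnertonDyer.Rank1Residual.Additive.StrictSignedSelmerLayerZero
import HarnessLib

/-!
# The EXACT strict-minus bottom-layer identity in cc-typer-6's currency:
# `ord_p #Sel_str(W/ℚ)[p^∞] + ord_p #(A₀ ⧸ Sel^{−,str}(W/ℚ_0)) = ord_p f(0)` (cell `b2b-bsdres`,
# CLASS-CLOSURE lane, class O10 — x1b GEN 34, class lead; file 43: the `K = ℚ`, `E = ℚ_[p]`,
# `ε = −1` instance of file 42, read on `strictSelmerPInfty W p` through p17's FILE 3)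

HONEST FRAMING (cell `b2b-bsdres`, run/shared/lean/b2b/bsd-rank1-residual/, verbatim in every
file): the goal of the cell is to DELETE the COMBINATION-SHAPED residual classes of the
Birch–Swinnerton-Dyer formula for ALL analytic-rank `≤ 1` elliptic curves over `ℚ` — "full BSD
formula for every rank `≤ 1` curve in class `C`" assembled STRICTLY from published theorems — so
that the rank-`≤ 1` remainder becomes exactly the CONSTRUCTION-SHAPED classes, which are TYPED
(missing-input `Prop`s), NOT attempted. This is not "finishing BSD". CLASS-CLOSURE lane: prove
what is provable now; shrink each hard class to its core with data; no claim beyond stated classes;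
research routes on CONSTRUCTION-SHAPED X12 / O10; census / instrument output = EVIDENCE / conjecture
items, NEVER a Literature fact; `RESIDUAL-MAP.md` marks change only by signed lines. THIS FILE:
TOOL THEOREMS ONLY — no definition, no named Literature fact, no Summits-side fact `def … : Prop`,
no `sorry`, axioms standard; nothing is booked; no label / mark / count / sub-cell moves; (C1_η),
(C2_η-GZ), (C3_η) stay typed as filed; O10 stays OPEN / CONSTRUCTION-SHAPED; nothing about `BSD(W, p)`
of any pair is claimed.

## What

p17's `StrictSignedControlZero.finite_and_padicValNat_card_strictSelmerPInfty_le` (the INEQUALITY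
`ord_p #Sel_str(W/ℚ)[p^∞] ≤ ord_p f(0)` for a strict-minus dual datum `D` with `X` f.g. torsion,
`char = (f)`, `f(0) ≠ 0`, no finite `Λ`-submodule, `W(ℚ_∞)[p^∞] = 0`) made EXACT: with
`A₀ = h₀⁻¹(Sel^{−,str}(W/ℚ_∞))` (classes over `ℚ` whose restriction to `ℚ_∞` is strict-minus
Selmer — Greenberg's `ker g₀` term),
**`ord_p #Sel_str(W/ℚ)[p^∞] + ord_p #(A₀ ⧸ Sel^{−,str}(W/ℚ_0)) = ord_p f(0)`**
(`StrictSignedControlZero.finite_and_padicValNat_card_add_eq` of file 42 +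
`natCard_strictSignedSelmerLayer_neg_one_zero_eq_strictSelmerPInfty`). In the (C3_η) derivation
(x1b GEN 31 `C3ETA-TRANSVERSALITY-x1b.md` §4) the defect is `ν + ord_p Tam(W)` — the GLOBAL count
(C), NOT proved here.

References: [Kobayashi2003] §2 p. 4, Lemma 9.1 (p. 25), Thm. 9.3 (p. 26); [GreenbergLNM1716] §3
Lemma 3.1–3.2, §4 Lemma 4.2 (p. 102); [Skinner2020] §2.2.
-/

noncomputable section

open scoped Classical

open WeierstrassCurve Literature.NumberTheory.EllipticCurves Literature.NumberTheory.GaloisRepresentations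
  Literature.NumberTheory.EllipticCurves.IwasawaAlgebra Literature.NumberTheory.EllipticCurves.IwasawaDual
  ZpExtension

namespace Summit.BirchSwinnertonDyer.Rank1Residual.Additive

namespace StrictSignedControlZero

variable (W : WeierstrassCurve ℚ) {p : ℕ} [Fact p.Prime] {κ : ZpExtension ℚ p}
  {γ : Field.absoluteGaloisGroup ℚ}

/-- **The strict-minus bottom-layer IDENTITY in cc-typer-6's currency.** For `W/ℚ`, a
`ℤ_p`-extension `κ` of `ℚ` with topological generator `γ`, a Pontryagin-dual datum `D` of
`Sel^{−,str}(W/ℚ_∞)` (model `ℚ_[p]`) with `X` finitely generated torsion, `char(X) = (f)`, `f(0) ≠ 0`,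
NO non-trivial finite `Λ`-submodule, and `W(ℚ_∞)[p^∞] = 0`: `Sel_str(W/ℚ)[p^∞]` and
`A₀ ⧸ Sel^{−,str}(W/ℚ_0)` (`A₀ = h₀⁻¹(Sel^{−,str}(W/ℚ_∞))`) are finite and
**`ord_p #Sel_str(W/ℚ)[p^∞] + ord_p #(A₀ ⧸ Sel^{−,str}(W/ℚ_0)) = ord_p f(0)`**. With (C1_η) READ on
`D` (`f = X⁻¹L⁻_p(V, η, X)` up to a unit) and Kitajima–Otsuki, this is the typed (C3_η) once the
defect is counted (`= ν + ord_p Tam(W)`, the global count (C) — not here).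
[cite: Kobayashi2003, Lemma 9.1 (p. 25), §2 p. 4] [cite: GreenbergLNM1716, §3 Lemma 3.2, §4 Lemma 4.2 (p. 102)] -/
theorem finite_and_padicValNat_card_strictSelmerPInfty_add_eq (hγ : κ.IsTopGenerator γ)
    (D : StrictSignedSelmerDualData W κ ℚ_[p] γ (-1))
    [Module.Finite (IwasawaAlgebra p) D.X] (hX : Module.IsTorsion (IwasawaAlgebra p) D.X)
    (hB : FixedPoints.addSubgroup κ.kerSubgroup (W.geomPrimaryTorsion p) = ⊥)
    (hnf : ∀ N : Submodule (IwasawaAlgebra p) D.X, Finite N → N = ⊥)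
    {f : IwasawaAlgebra p} (hf : D.charIdeal = Ideal.span {f})
    (h0 : PowerSeries.constantCoeff f ≠ 0) :
    Finite ↥(strictSelmerPInfty W p) ∧
      Finite (↥((strictSignedSelmerInfty W κ ℚ_[p] (-1)).comap (W.layerToInfty κ 0)) ⧸
        (strictSignedSelmerLayer W κ ℚ_[p] (-1) 0).addSubgroupOf
          ((strictSignedSelmerInfty W κ ℚ_[p] (-1)).comap (W.layerToInfty κ 0))) ∧
      (padicValNat p (Nat.card ↥(strictSelmerPInfty W p)) : ℤ) +
          padicValNat p (Nat.card (↥((strictSignedSelmerInfty W κ ℚ_[p] (-1)).comap (W.layerToInfty κ 0)) ⧸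
            (strictSignedSelmerLayer W κ ℚ_[p] (-1) 0).addSubgroupOf
              ((strictSignedSelmerInfty W κ ℚ_[p] (-1)).comap (W.layerToInfty κ 0)))) =
        ((PowerSeries.constantCoeff f : ℤ_[p]) : ℚ_[p]).valuation := by
  obtain ⟨hfin, hfinQ, heq⟩ := finite_and_padicValNat_card_add_eq W κ ℚ_[p] (-1) hγ D hX hB hnf hf h0
  have hcard := StrictSignedLayerZero.natCard_strictSignedSelmerLayer_neg_one_zero_eq_strictSelmerPInfty W κ
  haveI := hfin
  have hpos : 0 < Nat.card ↥(strictSignedSelmerLayer W κ ℚ_[p] (-1) 0) := Nat.card_pos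
  refine ⟨Nat.finite_of_card_ne_zero (by rw [← hcard]; exact hpos.ne'), hfinQ, ?_⟩
  rw [← hcard]
  exact heq

end StrictSignedControlZero

end Summit.BirchSwinnertonDyer.Rank1Residual.Additive

end
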